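import Literature.Barriers.Parity.SiegelZeroDichotomyPairHLMoebiusSlot
import Mathlib.MeasureTheory.Integral.Pi
import HarnessLib

/-!
# Tao–Teräväinen 2022, §8 (`k = 2`): moments of the six-slot weight

Topic `Literature/Barriers/Parity`, sub-namespace `TaoTeravainen`; bookkeeping for the integration of the
Euler-product error against the weight `W(τ) = ĝ_{c₁}(τ_{0,0}) f f ĝ_{c₂}(τ_{1,0}) f f` of
`SiegelZeroDichotomyPairHLSixSlotEuler.lean`, in the proof DAG of
`Literature.Barriers.Parity.TaoTeravainen2021_prop72_81_pair` (T. Tao, J. Teräväinen, *The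
Hardy–Littlewood–Chowla conjecture in the presence of a Siegel zero*, J. London Math. Soc. (2) 106 (2022),
arXiv:2109.06291), Lemma 8.2: "`F_j(t) ≪_A log^{O_{k,ε₀}(1)} η (1+|t|)^{-A}` and `f(t) ≪_A (1+|t|)^{-A}`"
— these decay bounds are what make every polynomially weighted moment of `|W|` finite and explicit.
Everything here is PROVED:

* `psiDecayConst M X U₀ n` (the constant `D_n` of `psiFourier_decay`);
* `integral_pow_mul_norm_psiFourier_le` — `∫ (1+U₀|τ|)^m |ĝ_c(τ)| dτ ≤ D_{m+2} π/U₀` (and integrability);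
* `integral_pow_mul_norm_sieveFourier_le` — `∫ (1+|τ|)^m |f(τ)| dτ ≤ C π` whenever `(1+|τ|)^{m+2}|f| ≤ C`;
* `integral_pi_prod_le_prod` — `∫_{ℝ^ι} ∏_k a_k(τ_k) dτ ≤ ∏_k I_k` for nonnegative integrable `a_k` with
  `∫ a_k ≤ I_k`. [cite: TaoTeravainen2021, Lemma 8.2 ((8.14), proof)]
-/

noncomputable section

open Real MeasureTheory Finset

namespace Literature.Barriers.Parity

namespace TaoTeravainen

/-- The decay constant `D_n = 2ⁿ · 6e · U₀ · (1+n)(X+2U₀) ∑_{i≤n} M_i` of `psiFourier_decay`.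
[cite: TaoTeravainen2021, Lemma 8.2 (8.14)] -/
def psiDecayConst (M : ℕ → ℝ) (X U₀ : ℝ) (n : ℕ) : ℝ :=
  2 ^ n * (6 * Real.exp 1) * U₀ * ((1 + n) * (X + 2 * U₀) * cutoffDerivSum M n)

/-- `D_n ≥ 0` (for `U₀ ≥ 0`, `X + 2U₀ ≥ 0`, `M ≥ 0`). [folklore] -/
theorem psiDecayConst_nonneg {M : ℕ → ℝ} (hM : ∀ i, 0 ≤ M i) {X U₀ : ℝ} (hU₀ : 0 ≤ U₀) (hXU : 0 ≤ X + 2 * U₀)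
    (n : ℕ) : 0 ≤ psiDecayConst M X U₀ n := by
  unfold psiDecayConst
  have : 0 ≤ cutoffDerivSum M n := Finset.sum_nonneg fun i _ => hM i
  positivity

/-- **Weighted moments of `|ĝ_c|`**: `∫ (1+U₀|τ|)^m |ĝ_c(τ)| dτ ≤ D_{m+2} · π/U₀`, and the integrand is
integrable (`|ψ⁽ⁱ⁾| ≤ M_i`, `U₀ ≥ 1`, `2U₀+2 ≤ X`, `c ≤ X+1`). [cite: TaoTeravainen2021, Lemma 8.2 (8.14)] -/
theorem integral_pow_mul_norm_psiFourier_le {φ ψ : ℝ → ℝ} (hφ : IsBump φ) (hψ : IsSmoothCutoff ψ)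
    {M : ℕ → ℝ} (hM : ∀ i u, |iteratedDeriv i ψ u| ≤ M i) {X U₀ : ℝ} (hU₀ : 1 ≤ U₀) (hX : 2 * U₀ + 2 ≤ X)
    {c : ℝ} (hc : c ≤ X + 1) (m : ℕ) :
    Integrable (fun τ : ℝ => (1 + U₀ * |τ|) ^ m * ‖psiFourier φ ψ X U₀ c τ‖) ∧
      ∫ τ : ℝ, (1 + U₀ * |τ|) ^ m * ‖psiFourier φ ψ X U₀ c τ‖ ≤ psiDecayConst M X U₀ (m + 2) * (π / U₀) := by
  have hU₀0 : 0 < U₀ := by linarith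
  have hM0 : ∀ i, 0 ≤ M i := fun i => (abs_nonneg _).trans (hM i 0)
  set D := psiDecayConst M X U₀ (m + 2) with hD
  have hD0 : 0 ≤ D := psiDecayConst_nonneg hM0 hU₀0.le (by linarith) _
  have hdecay : ∀ τ, (1 + U₀ * |τ|) ^ (m + 2) * ‖psiFourier φ ψ X U₀ c τ‖ ≤ D := fun τ => by
    have h := psiFourier_decay hφ hψ hM hU₀ hX hc (m + 2) τ
    rw [hD]; unfold psiDecayConst; exact_mod_cast h
  -- pointwise majorant `D (1 + (U₀τ)²)⁻¹`
  have hpt : ∀ τ, (1 + U₀ * |τ|) ^ m * ‖psiFourier φ ψ X U₀ c τ‖ ≤ D * (1 + (U₀ * τ) ^ 2)⁻¹ := by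
    intro τ
    have hw : 1 ≤ 1 + U₀ * |τ| := by have := abs_nonneg τ; nlinarith
    have hw2 : 1 + (U₀ * τ) ^ 2 ≤ (1 + U₀ * |τ|) ^ 2 := by
      have h0 : 0 ≤ U₀ * |τ| := by positivity
      have : (U₀ * τ) ^ 2 = (U₀ * |τ|) ^ 2 := by rw [mul_pow, mul_pow, sq_abs]
      rw [this]; nlinarith
    have hpos : 0 < 1 + (U₀ * τ) ^ 2 := by positivity
    rw [← div_eq_mul_inv, le_div_iff₀ hpos]
    calc (1 + U₀ * |τ|) ^ m * ‖psiFourier φ ψ X U₀ c τ‖ * (1 + (U₀ * τ) ^ 2)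
        ≤ (1 + U₀ * |τ|) ^ m * ‖psiFourier φ ψ X U₀ c τ‖ * (1 + U₀ * |τ|) ^ 2 :=
          mul_le_mul_of_nonneg_left hw2 (by positivity)
      _ = (1 + U₀ * |τ|) ^ (m + 2) * ‖psiFourier φ ψ X U₀ c τ‖ := by rw [pow_add]; ring
      _ ≤ D := hdecay τ
  have hcontF : Continuous (psiFourier φ ψ X U₀ c) :=
    VectorFourier.fourierIntegral_continuous Real.continuous_fourierChar (by exact continuous_inner)
      ((contDiff_psiTwist hφ hψ X hU₀0 c).continuous.integrable_of_hasCompactSupport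
        (hasCompactSupport_psiTwist hφ hψ X hU₀0 c))
  have hcont : Continuous fun τ : ℝ => (1 + U₀ * |τ|) ^ m * ‖psiFourier φ ψ X U₀ c τ‖ := by fun_prop
  have hmaj : Integrable fun τ : ℝ => D * (1 + (U₀ * τ) ^ 2)⁻¹ := (integrable_inv_one_add_mul_sq hU₀0.ne').const_mul D
  have hint : Integrable (fun τ : ℝ => (1 + U₀ * |τ|) ^ m * ‖psiFourier φ ψ X U₀ c τ‖) :=
    hmaj.mono' hcont.aestronglyMeasurable (Filter.Eventually.of_forall fun τ => by
      rw [Real.norm_of_nonneg (by positivity)]; exact hpt τ)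
  refine ⟨hint, ?_⟩
  calc ∫ τ : ℝ, (1 + U₀ * |τ|) ^ m * ‖psiFourier φ ψ X U₀ c τ‖ ≤ ∫ τ : ℝ, D * (1 + (U₀ * τ) ^ 2)⁻¹ :=
        integral_mono hint hmaj hpt
    _ = D * (π / U₀) := by rw [integral_const_mul, integral_inv_one_add_mul_sq hU₀0]

/-- **Weighted moments of `|f|`**: if `(1+|τ|)^{m+2} |f(τ)| ≤ C` then `∫ (1+|τ|)^m |f(τ)| dτ ≤ C π`.
[cite: TaoTeravainen2021, Lemma 8.2 ("`f(t) ≪_A (1+|t|)^{-A}`")] -/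
theorem integral_pow_mul_norm_sieveFourier_le {ψ : ℝ → ℝ} (hψ : IsSmoothCutoff ψ) (m : ℕ) {C : ℝ}
    (hC : ∀ τ : ℝ, (1 + |τ|) ^ (m + 2) * ‖sieveFourier ψ τ‖ ≤ C) :
    ∫ τ : ℝ, (1 + |τ|) ^ m * ‖sieveFourier ψ τ‖ ≤ C * π := by
  have hC0 : 0 ≤ C := le_trans (by positivity) (hC 0)
  have hpt : ∀ τ, (1 + |τ|) ^ m * ‖sieveFourier ψ τ‖ ≤ C * (1 + (1 * τ) ^ 2)⁻¹ := by
    intro τ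
    have hw2 : 1 + (1 * τ) ^ 2 ≤ (1 + |τ|) ^ 2 := by
      rw [one_mul, ← sq_abs]; have := abs_nonneg τ; nlinarith
    have hpos : 0 < 1 + (1 * τ) ^ 2 := by positivity
    rw [← div_eq_mul_inv, le_div_iff₀ hpos]
    calc (1 + |τ|) ^ m * ‖sieveFourier ψ τ‖ * (1 + (1 * τ) ^ 2)
        ≤ (1 + |τ|) ^ m * ‖sieveFourier ψ τ‖ * (1 + |τ|) ^ 2 := mul_le_mul_of_nonneg_left hw2 (by positivity)
      _ = (1 + |τ|) ^ (m + 2) * ‖sieveFourier ψ τ‖ := by rw [pow_add]; ring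
      _ ≤ C := hC τ
  have hmaj : Integrable fun τ : ℝ => C * (1 + (1 * τ) ^ 2)⁻¹ := (integrable_inv_one_add_mul_sq one_ne_zero).const_mul C
  calc ∫ τ : ℝ, (1 + |τ|) ^ m * ‖sieveFourier ψ τ‖ ≤ ∫ τ : ℝ, C * (1 + (1 * τ) ^ 2)⁻¹ :=
        integral_mono (integrable_pow_mul_norm_sieveFourier hψ m) hmaj hpt
    _ = C * π := by rw [integral_const_mul, integral_inv_one_add_mul_sq one_pos, div_one]

/-- **Fubini for nonnegative majorants**: `∫_{ℝ^ι} ∏_k a_k(τ_k) dτ ≤ ∏_k I_k` when `0 ≤ a_k`, each `a_k` is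
integrable and `∫ a_k ≤ I_k`; the product is integrable. [folklore] -/
theorem integral_pi_prod_le_prod {ι : Type*} [Fintype ι] (a : ι → ℝ → ℝ) (h0 : ∀ k τ, 0 ≤ a k τ)
    (hint : ∀ k, Integrable (a k)) {I : ι → ℝ} (hI : ∀ k, ∫ τ, a k τ ≤ I k) :
    Integrable (fun τ : ι → ℝ => ∏ k, a k (τ k)) ∧ ∫ τ : ι → ℝ, ∏ k, a k (τ k) ≤ ∏ k, I k := by
  have h1 : Integrable (fun τ : ι → ℝ => ∏ k, a k (τ k)) (Measure.pi fun _ : ι => (volume : Measure ℝ)) :=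
    Integrable.fintype_prod (f := a) hint
  rw [← volume_pi] at h1
  refine ⟨h1, ?_⟩
  rw [integral_fintype_prod_volume_eq_prod (𝕜 := ℝ) a]
  exact prod_le_prod (fun k _ => integral_nonneg (h0 k)) fun k _ => hI k

end TaoTeravainen

end Literature.Barriers.Parity
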